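import Summits.AtomisticToContinuum.FouriersLaw.Theorems.OddSectorIrreversibilityResponseDensityForecastGradient
import Summits.AtomisticToContinuum.FouriersLaw.Theorems.OddSectorIrreversibilityResponseDensityCutoffEnergy

/-!
# The carré-du-champ energy estimate for the forecasts of the pinned chain at equilibrium

Helper file for item stmt-AtomisticToContinuum-9144 (`ResponseDensity`, route
`OddSectorIrreversibility`, sub-problem `FouriersLaw` of `AtomisticToContinuum`), part of the
detailed-balance (hDUAL) line. Both baths at temperature `T > 0`, `π = e^{-H/T}`, `F ∈ C_c^∞`,
`u_s = P_s F`, `Γ = carreDuChamp v_L v_R`, `χ ∈ C_c^∞` (later `χ_R = χ(H/R)`):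

* `pinnedChain_energy_ineq` — **the differential inequality**
  `½ ∫ π χ² Γ(u_s) dx ≤ -∫ πχ² 2u_s P_s(LF) dx + ∫ π u_s² (8Γ(χ) - L(χ²)) dx` (`s > 0`), from
  `∫ π L(χ² u_s²) dx = 0` (`…GibbsTranspose.lean`), the product rules, the commutation
  `L u_s = P_s(LF)` (`…BackwardPDE.lean`) and `-Γ(χ², u²) ≤ ½χ²Γ(u) + 8u²Γ(χ)`;
* `pinnedChain_energy_estimate` — **the integrated estimate**
  `∫_{s₀}^{s₁} ∫ π χ² Γ(u_s) dx ds ≤ 2 (C_F² ∫ π χ² dx + (s₁ - s₀) C_F² ∫ π |8Γ(χ) - L(χ²)| dx)`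
  (`0 < s₀ ≤ s₁`, `|F| ≤ C_F`), by the fundamental theorem of calculus for `s ↦ ∫ πχ² u_s² dx`;
* `pinnedChain_continuousOn_energyDensity` — `s ↦ ∫ π χ² Γ(u_s) dx` is continuous on `(0,∞)`.

No definitions.
-/

noncomputable section

open MeasureTheory ProbabilityTheory Filter Topology Set Function Metric
open scoped NNReal ENNReal ContDiff

namespace Summit.AtomisticToContinuum.FouriersLaw.Theorems

open Literature.MathematicalPhysics.KineticTheory.HeatConduction
open Literature.Probability.Process Literature.MathematicalPhysics.KineticTheory OscillatorChain

variable {N : ℕ}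

section Energy

variable {ω₂ lam β γ : ℝ} (hω : 0 < ω₂) (hl : 0 ≤ lam) (hβ : 0 ≤ β) (hγ : 0 < γ) (hN : 0 < N)
  {T : ℝ} (hT : 0 < T) {F : PhaseSpace N → ℝ} (hF : ContDiff ℝ ∞ F) (hFc : HasCompactSupport F)
  {χ : PhaseSpace N → ℝ} (hχ : ContDiff ℝ ∞ χ) (hχc : HasCompactSupport χ)
include hω hl hβ hγ hN hT hF hFc hχ hχc

/-- **The differential energy inequality** at a time `s > 0`:
`½ ∫ π χ² Γ(u_s) dx ≤ -∫ πχ² · 2 u_s P_s(LF) dx + ∫ π u_s² (8Γ(χ) - L(χ²)) dx`. -/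
theorem pinnedChain_energy_ineq {s : ℝ} (hs : 0 < s) :
    (1 / 2) * ∫ x, (pinnedChain ω₂ lam β γ).gibbsDensity N T x * (χ x ^ 2 *
        carreDuChamp ((pinnedChain ω₂ lam β γ).bathVecL N T) ((pinnedChain ω₂ lam β γ).bathVecR N T)
          (fun z => ∫ y, F y ∂((pinnedChain ω₂ lam β γ).transitionKernel N T T s.toNNReal z))
          (fun z => ∫ y, F y ∂((pinnedChain ω₂ lam β γ).transitionKernel N T T s.toNNReal z)) x) ≤
      -(∫ x, (pinnedChain ω₂ lam β γ).gibbsDensity N T x * χ x ^ 2 *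
          (2 * (∫ y, F y ∂((pinnedChain ω₂ lam β γ).transitionKernel N T T s.toNNReal x)) *
            ∫ y, (pinnedChain ω₂ lam β γ).generator N T T F y
              ∂((pinnedChain ω₂ lam β γ).transitionKernel N T T s.toNNReal x))) +
        ∫ x, (pinnedChain ω₂ lam β γ).gibbsDensity N T x *
          ((∫ y, F y ∂((pinnedChain ω₂ lam β γ).transitionKernel N T T s.toNNReal x)) ^ 2 *
            (8 * carreDuChamp ((pinnedChain ω₂ lam β γ).bathVecL N T) ((pinnedChain ω₂ lam β γ).bathVecR N T) χ χ x -
              (pinnedChain ω₂ lam β γ).generator N T T (fun z => χ z ^ 2) x)) := by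
  haveI := isAddHaarMeasure_volume_phaseSpace N
  have hU : ContDiff ℝ ∞ (pinnedChain ω₂ lam β γ).U := pinnedChain_contDiff_U ω₂ lam β γ
  have hV : ContDiff ℝ ∞ (pinnedChain ω₂ lam β γ).V := pinnedChain_contDiff_V ω₂ lam β γ
  have hγT : 0 ≤ (pinnedChain ω₂ lam β γ).γ * T := mul_nonneg hγ.le hT.le
  have hF2 : ContDiff ℝ 2 F := hF.of_le (by norm_cast)
  obtain ⟨CF, hCF⟩ : ∃ C, ∀ y, ‖F y‖ ≤ C := hF.continuous.bounded_above_of_compact_support hFc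
  have hLc : Continuous ((pinnedChain ω₂ lam β γ).generator N T T F) :=
    (pinnedChain ω₂ lam β γ).continuous_generator (pinnedChain_contDiff_U ω₂ lam β γ)
      (pinnedChain_contDiff_V ω₂ lam β γ) N T T hF2
  obtain ⟨CL, hCL⟩ := (pinnedChain ω₂ lam β γ).exists_bound_generator (pinnedChain_contDiff_U ω₂ lam β γ)
    (pinnedChain_contDiff_V ω₂ lam β γ) N T T hF2 hFc
  -- names: `u = u_s`, `g = P_s(LF)`, `π`, `Γ`
  obtain ⟨u, hu⟩ : ∃ u : PhaseSpace N → ℝ, u = fun z =>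
      ∫ y, F y ∂((pinnedChain ω₂ lam β γ).transitionKernel N T T s.toNNReal z) := ⟨_, rfl⟩
  obtain ⟨g, hg⟩ : ∃ g : PhaseSpace N → ℝ, g = fun z => ∫ y, (pinnedChain ω₂ lam β γ).generator N T T F y
      ∂((pinnedChain ω₂ lam β γ).transitionKernel N T T s.toNNReal z) := ⟨_, rfl⟩
  obtain ⟨π, hπ⟩ : ∃ π : PhaseSpace N → ℝ, π = (pinnedChain ω₂ lam β γ).gibbsDensity N T := ⟨_, rfl⟩
  -- restate the goal with the names
  suffices hgoal : (1 / 2) * ∫ x, π x * (χ x ^ 2 *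
      carreDuChamp ((pinnedChain ω₂ lam β γ).bathVecL N T) ((pinnedChain ω₂ lam β γ).bathVecR N T) u u x) ≤
      -(∫ x, π x * χ x ^ 2 * (2 * u x * g x)) +
        ∫ x, π x * (u x ^ 2 * (8 * carreDuChamp ((pinnedChain ω₂ lam β γ).bathVecL N T)
          ((pinnedChain ω₂ lam β γ).bathVecR N T) χ χ x - (pinnedChain ω₂ lam β γ).generator N T T (fun z => χ z ^ 2) x)) by
    rw [hu, hg, hπ] at hgoal
    exact hgoal
  -- regularity
  have hsm : ContDiff ℝ ∞ u := by
    have h := pinnedChain_contDiffOn_forecast hω hl hβ hγ hN hT hT.le hF.continuous hFc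
    have h2 := h.comp_contDiff (contDiff_const.prodMk contDiff_id) fun z => ⟨hs, Set.mem_univ _⟩
    rw [hu]; exact h2
  have hu2 : ContDiff ℝ 2 u := hsm.of_le (by norm_cast)
  have hud : Differentiable ℝ u := hsm.differentiable (by simp)
  have hχd : Differentiable ℝ χ := hχ.differentiable (by simp)
  have hχ2 : ContDiff ℝ 2 χ := hχ.of_le (by norm_cast)
  have hcomm : ∀ x, (pinnedChain ω₂ lam β γ).generator N T T u x = g x := by
    intro x; rw [hu, hg]
    exact pinnedChain_generator_forecast_eq hω hl hβ hγ hN hT hT.le hF hFc hs x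
  have hπc : Continuous π := by
    rw [hπ]; exact Real.continuous_exp.comp (((pinnedChain_contDiff_hamiltonian ω₂ lam β γ N (n := 0)).continuous).neg.div_const T)
  have hπ0 : ∀ x, 0 < π x := fun x => by rw [hπ]; exact (pinnedChain ω₂ lam β γ).gibbsDensity_pos N T x
  have huc : Continuous u := hsm.continuous
  have hgc : Continuous g := by
    rw [hg]; exact pinnedChain_continuous_integral_transitionKernel hω hl hβ hγ.le N T T _ hLc hCL
  have hΓuc : Continuous (carreDuChamp ((pinnedChain ω₂ lam β γ).bathVecL N T)
      ((pinnedChain ω₂ lam β γ).bathVecR N T) u u) := by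
    have hD : Continuous (fderiv ℝ u) := hsm.continuous_fderiv (by simp)
    simp only [show carreDuChamp ((pinnedChain ω₂ lam β γ).bathVecL N T) ((pinnedChain ω₂ lam β γ).bathVecR N T) u u =
      fun x => _ from funext fun x => carreDuChamp_def _ _ u u x]
    fun_prop
  have hΓχc : Continuous (carreDuChamp ((pinnedChain ω₂ lam β γ).bathVecL N T)
      ((pinnedChain ω₂ lam β γ).bathVecR N T) χ χ) := by
    have hD : Continuous (fderiv ℝ χ) := hχ.continuous_fderiv (by simp)
    simp only [show carreDuChamp ((pinnedChain ω₂ lam β γ).bathVecL N T) ((pinnedChain ω₂ lam β γ).bathVecR N T) χ χ =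
      fun x => _ from funext fun x => carreDuChamp_def _ _ χ χ x]
    fun_prop
  have hΓχu : Continuous (carreDuChamp ((pinnedChain ω₂ lam β γ).bathVecL N T)
      ((pinnedChain ω₂ lam β γ).bathVecR N T) (fun y => χ y ^ 2) (fun y => u y ^ 2)) := by
    have e : carreDuChamp ((pinnedChain ω₂ lam β γ).bathVecL N T) ((pinnedChain ω₂ lam β γ).bathVecR N T)
        (fun y => χ y ^ 2) (fun y => u y ^ 2) =
        fun x => 4 * χ x * u x * carreDuChamp ((pinnedChain ω₂ lam β γ).bathVecL N T)
          ((pinnedChain ω₂ lam β γ).bathVecR N T) χ u x := funext fun x => carreDuChamp_sq_sq _ _ hχd hud x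
    have hD : Continuous (fderiv ℝ χ) := hχ.continuous_fderiv (by simp)
    have hD' : Continuous (fderiv ℝ u) := hsm.continuous_fderiv (by simp)
    rw [e]
    simp only [carreDuChamp_def]
    fun_prop
  have hLχ2 : Continuous ((pinnedChain ω₂ lam β γ).generator N T T fun z => χ z ^ 2) :=
    (pinnedChain ω₂ lam β γ).continuous_generator (pinnedChain_contDiff_U ω₂ lam β γ)
      (pinnedChain_contDiff_V ω₂ lam β γ) N T T (hχ2.pow 2)
  -- supports
  have hχ2c : HasCompactSupport fun y => χ y ^ 2 := by
    have e : (fun y => χ y ^ 2) = fun y => χ y * χ y := funext fun y => sq _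
    rw [e]; exact hχc.mul_right
  have hΓχs : HasCompactSupport (carreDuChamp ((pinnedChain ω₂ lam β γ).bathVecL N T)
      ((pinnedChain ω₂ lam β γ).bathVecR N T) χ χ) := by
    rw [show carreDuChamp ((pinnedChain ω₂ lam β γ).bathVecL N T) ((pinnedChain ω₂ lam β γ).bathVecR N T) χ χ =
      fun x => _ from funext fun x => carreDuChamp_def _ _ χ χ x]
    exact ((hχc.fderiv_apply (𝕜 := ℝ) _).mul_right).add ((hχc.fderiv_apply (𝕜 := ℝ) _).mul_right)
  have hLχ2s : HasCompactSupport ((pinnedChain ω₂ lam β γ).generator N T T fun z => χ z ^ 2) :=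
    (pinnedChain ω₂ lam β γ).hasCompactSupport_generator N T T (hχ2.pow 2) hχ2c
  -- the invariance identity `∫ π (χ² L(u²) + u² L(χ²) + Γ(χ², u²)) = 0`
  have h0raw := langevin_integral_gibbs_generator_mul_add (pinnedChain ω₂ lam β γ) hU hV hN hγ.le hT
    (hχ.pow 2) hχ2c (hsm.pow 2)
  have h0 : ∫ x, π x * ((χ x ^ 2) * (pinnedChain ω₂ lam β γ).generator N T T (fun y => u y ^ 2) x +
      (u x ^ 2) * (pinnedChain ω₂ lam β γ).generator N T T (fun y => χ y ^ 2) x +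
      carreDuChamp ((pinnedChain ω₂ lam β γ).bathVecL N T) ((pinnedChain ω₂ lam β γ).bathVecR N T)
        (fun y => χ y ^ 2) (fun y => u y ^ 2) x) = 0 := by
    rw [hπ]; exact h0raw
  -- `L(u²) = 2 u g + Γ(u)`
  have hLu2 : ∀ x, (pinnedChain ω₂ lam β γ).generator N T T (fun y => u y ^ 2) x =
      2 * u x * g x + carreDuChamp ((pinnedChain ω₂ lam β γ).bathVecL N T)
        ((pinnedChain ω₂ lam β γ).bathVecR N T) u u x := by
    intro x
    rw [← (pinnedChain ω₂ lam β γ).sdeGenerator_drift_eq_generator hN hγT hγT (hu2.pow 2),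
      sdeGenerator_sq _ _ _ hu2, (pinnedChain ω₂ lam β γ).sdeGenerator_drift_eq_generator hN hγT hγT hu2, hcomm]
  -- the three integrands
  have iA : Integrable (fun x => π x * (χ x ^ 2 * carreDuChamp ((pinnedChain ω₂ lam β γ).bathVecL N T)
      ((pinnedChain ω₂ lam β γ).bathVecR N T) u u x)) :=
    (hπc.mul ((hχ.continuous.pow 2).mul hΓuc)).integrable_of_hasCompactSupport (hχ2c.mul_right.mul_left)
  have iB : Integrable (fun x => π x * χ x ^ 2 * (2 * u x * g x)) :=
    ((hπc.mul (hχ.continuous.pow 2)).mul ((continuous_const.mul huc).mul hgc)).integrable_of_hasCompactSupport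
      (hχ2c.mul_left.mul_right)
  have iC : Integrable (fun x => π x * (u x ^ 2 * (8 * carreDuChamp ((pinnedChain ω₂ lam β γ).bathVecL N T)
      ((pinnedChain ω₂ lam β γ).bathVecR N T) χ χ x - (pinnedChain ω₂ lam β γ).generator N T T (fun z => χ z ^ 2) x))) :=
    (hπc.mul ((huc.pow 2).mul ((continuous_const.mul hΓχc).sub hLχ2))).integrable_of_hasCompactSupport
      (((hΓχs.mul_left (f := fun _ => (8 : ℝ))).sub hLχ2s).mul_left.mul_left)
  have iD : Integrable (fun x => π x * ((χ x ^ 2) * (pinnedChain ω₂ lam β γ).generator N T T (fun y => u y ^ 2) x +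
      (u x ^ 2) * (pinnedChain ω₂ lam β γ).generator N T T (fun y => χ y ^ 2) x +
      carreDuChamp ((pinnedChain ω₂ lam β γ).bathVecL N T) ((pinnedChain ω₂ lam β γ).bathVecR N T)
        (fun y => χ y ^ 2) (fun y => u y ^ 2) x)) := by
    have hLu2c : Continuous ((pinnedChain ω₂ lam β γ).generator N T T fun y => u y ^ 2) :=
      (pinnedChain ω₂ lam β γ).continuous_generator (pinnedChain_contDiff_U ω₂ lam β γ)
        (pinnedChain_contDiff_V ω₂ lam β γ) N T T (hu2.pow 2)
    refine (hπc.mul ((((hχ.continuous.pow 2).mul hLu2c).add ((huc.pow 2).mul hLχ2)).add hΓχu)).integrable_of_hasCompactSupport ?_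
    refine HasCompactSupport.mul_left (HasCompactSupport.add (HasCompactSupport.add hχ2c.mul_right hLχ2s.mul_left) ?_)
    rw [show carreDuChamp ((pinnedChain ω₂ lam β γ).bathVecL N T) ((pinnedChain ω₂ lam β γ).bathVecR N T)
        (fun y => χ y ^ 2) (fun y => u y ^ 2) = fun x => 4 * χ x * u x * carreDuChamp ((pinnedChain ω₂ lam β γ).bathVecL N T)
          ((pinnedChain ω₂ lam β γ).bathVecR N T) χ u x from funext fun x => carreDuChamp_sq_sq _ _ hχd hud x]
    exact (hχc.mul_left.mul_right).mul_right
  -- pointwise comparison `½A + B - C ≤ D`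
  have hpt : ∀ x, (1 / 2) * (π x * (χ x ^ 2 * carreDuChamp ((pinnedChain ω₂ lam β γ).bathVecL N T)
      ((pinnedChain ω₂ lam β γ).bathVecR N T) u u x)) + π x * χ x ^ 2 * (2 * u x * g x) -
      π x * (u x ^ 2 * (8 * carreDuChamp ((pinnedChain ω₂ lam β γ).bathVecL N T)
        ((pinnedChain ω₂ lam β γ).bathVecR N T) χ χ x - (pinnedChain ω₂ lam β γ).generator N T T (fun z => χ z ^ 2) x)) ≤
      π x * ((χ x ^ 2) * (pinnedChain ω₂ lam β γ).generator N T T (fun y => u y ^ 2) x +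
        (u x ^ 2) * (pinnedChain ω₂ lam β γ).generator N T T (fun y => χ y ^ 2) x +
        carreDuChamp ((pinnedChain ω₂ lam β γ).bathVecL N T) ((pinnedChain ω₂ lam β γ).bathVecR N T)
          (fun y => χ y ^ 2) (fun y => u y ^ 2) x) := by
    intro x
    rw [hLu2 x]
    have hcs := neg_carreDuChamp_sq_sq_le ((pinnedChain ω₂ lam β γ).bathVecL N T)
      ((pinnedChain ω₂ lam β γ).bathVecR N T) hχd hud x
    have hπx := (hπ0 x).le
    nlinarith [mul_le_mul_of_nonneg_left hcs hπx]
  have hint := integral_mono ((iA.const_mul (1 / 2)).add iB |>.sub iC) iD hpt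
  rw [integral_sub' ((iA.const_mul (1 / 2)).add iB) iC, integral_add' (iA.const_mul (1 / 2)) iB, h0] at hint
  rw [integral_const_mul] at hint
  linarith


/-- **The energy density `s ↦ ∫ π χ² Γ(u_s) dx` is continuous on `(0,∞)`.** -/
theorem pinnedChain_continuousOn_energyDensity :
    ContinuousOn (fun s : ℝ => ∫ x, (pinnedChain ω₂ lam β γ).gibbsDensity N T x * (χ x ^ 2 *
        carreDuChamp ((pinnedChain ω₂ lam β γ).bathVecL N T) ((pinnedChain ω₂ lam β γ).bathVecR N T)
          (fun z => ∫ y, F y ∂((pinnedChain ω₂ lam β γ).transitionKernel N T T s.toNNReal z))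
          (fun z => ∫ y, F y ∂((pinnedChain ω₂ lam β γ).transitionKernel N T T s.toNNReal z)) x))
      (Set.Ioi 0) := by
  have hπc : Continuous ((pinnedChain ω₂ lam β γ).gibbsDensity N T) :=
    Real.continuous_exp.comp (((pinnedChain_contDiff_hamiltonian ω₂ lam β γ N (n := 0)).continuous).neg.div_const T)
  have hχ2s : HasCompactSupport fun y => χ y ^ 2 := by
    have e : (fun y => χ y ^ 2) = fun y => χ y * χ y := funext fun y => sq _
    rw [e]; exact hχc.mul_right
  have hΓUc := pinnedChain_continuousOn_carreDuChamp_forecast hω hl hβ hγ hN hT hT.le hF hFc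
    ((pinnedChain ω₂ lam β γ).bathVecL N T) ((pinnedChain ω₂ lam β γ).bathVecR N T)
  have hπ2 : ContinuousOn (fun w : ℝ × PhaseSpace N => (pinnedChain ω₂ lam β γ).gibbsDensity N T w.2)
      (Set.Ioi 0 ×ˢ Set.univ) := (hπc.comp continuous_snd).continuousOn
  have hχ2' : ContinuousOn (fun w : ℝ × PhaseSpace N => χ w.2 ^ 2) (Set.Ioi 0 ×ˢ Set.univ) :=
    ((hχ.continuous.comp continuous_snd).pow 2).continuousOn
  refine continuousOn_integral_of_continuousOn_prod (Φ := fun w => (pinnedChain ω₂ lam β γ).gibbsDensity N T w.2 *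
    (χ w.2 ^ 2 * carreDuChamp ((pinnedChain ω₂ lam β γ).bathVecL N T) ((pinnedChain ω₂ lam β γ).bathVecR N T)
      (fun z => ∫ y, F y ∂((pinnedChain ω₂ lam β γ).transitionKernel N T T w.1.toNNReal z))
      (fun z => ∫ y, F y ∂((pinnedChain ω₂ lam β γ).transitionKernel N T T w.1.toNNReal z)) w.2))
    (hπ2.mul (hχ2'.mul hΓUc)) hχ2s.isCompact fun s x hx => ?_
  simp [image_eq_zero_of_notMem_tsupport hx]

/-- **The integrated energy estimate**: for `0 < s₀ ≤ s₁` and `|F| ≤ C_F`,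
`∫_{s₀}^{s₁} ∫ π χ² Γ(u_s) dx ds ≤ 2 (C_F² ∫ π χ² dx + (s₁ - s₀) C_F² ∫ π |8Γ(χ) - L(χ²)| dx)`. -/
theorem pinnedChain_energy_estimate {CF : ℝ} (hCF : ∀ y, |F y| ≤ CF) {s₀ s₁ : ℝ} (hs₀ : 0 < s₀)
    (hs₀₁ : s₀ ≤ s₁) :
    ∫ s in s₀..s₁, ∫ x, (pinnedChain ω₂ lam β γ).gibbsDensity N T x * (χ x ^ 2 *
        carreDuChamp ((pinnedChain ω₂ lam β γ).bathVecL N T) ((pinnedChain ω₂ lam β γ).bathVecR N T)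
          (fun z => ∫ y, F y ∂((pinnedChain ω₂ lam β γ).transitionKernel N T T s.toNNReal z))
          (fun z => ∫ y, F y ∂((pinnedChain ω₂ lam β γ).transitionKernel N T T s.toNNReal z)) x) ≤
      2 * (CF ^ 2 * (∫ x, (pinnedChain ω₂ lam β γ).gibbsDensity N T x * χ x ^ 2) +
        (s₁ - s₀) * (CF ^ 2 * ∫ x, (pinnedChain ω₂ lam β γ).gibbsDensity N T x *
          |8 * carreDuChamp ((pinnedChain ω₂ lam β γ).bathVecL N T) ((pinnedChain ω₂ lam β γ).bathVecR N T) χ χ x -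
            (pinnedChain ω₂ lam β γ).generator N T T (fun z => χ z ^ 2) x|)) := by
  haveI := isAddHaarMeasure_volume_phaseSpace N
  have hF2 : ContDiff ℝ 2 F := hF.of_le (by norm_cast)
  have hχ2 : ContDiff ℝ 2 χ := hχ.of_le (by norm_cast)
  have hχd : Differentiable ℝ χ := hχ.differentiable (by simp)
  have hLc : Continuous ((pinnedChain ω₂ lam β γ).generator N T T F) :=
    (pinnedChain ω₂ lam β γ).continuous_generator (pinnedChain_contDiff_U ω₂ lam β γ)
      (pinnedChain_contDiff_V ω₂ lam β γ) N T T hF2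
  have hLs : HasCompactSupport ((pinnedChain ω₂ lam β γ).generator N T T F) :=
    (pinnedChain ω₂ lam β γ).hasCompactSupport_generator N T T hF2 hFc
  obtain ⟨CL, hCL⟩ := (pinnedChain ω₂ lam β γ).exists_bound_generator (pinnedChain_contDiff_U ω₂ lam β γ)
    (pinnedChain_contDiff_V ω₂ lam β γ) N T T hF2 hFc
  have hCF0 : 0 ≤ CF := (abs_nonneg _).trans (hCF 0)
  -- names
  obtain ⟨u, hu⟩ : ∃ u : ℝ → PhaseSpace N → ℝ, u = fun r z =>
      ∫ y, F y ∂((pinnedChain ω₂ lam β γ).transitionKernel N T T r.toNNReal z) := ⟨_, rfl⟩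
  obtain ⟨g, hg⟩ : ∃ g : ℝ → PhaseSpace N → ℝ, g = fun r z => ∫ y, (pinnedChain ω₂ lam β γ).generator N T T F y
      ∂((pinnedChain ω₂ lam β γ).transitionKernel N T T r.toNNReal z) := ⟨_, rfl⟩
  set π := (pinnedChain ω₂ lam β γ).gibbsDensity N T with hπ
  set Γχ := carreDuChamp ((pinnedChain ω₂ lam β γ).bathVecL N T) ((pinnedChain ω₂ lam β γ).bathVecR N T) χ χ
    with hΓχ
  set Lχ2 := (pinnedChain ω₂ lam β γ).generator N T T (fun z => χ z ^ 2) with hLχ2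
  have hux : ∀ r z, u r z = ∫ y, F y ∂((pinnedChain ω₂ lam β γ).transitionKernel N T T r.toNNReal z) :=
    fun r z => by rw [hu]
  -- the three functions of time
  obtain ⟨a, ha⟩ : ∃ a : ℝ → ℝ, a = fun r => ∫ x, π x * (χ x ^ 2 *
      carreDuChamp ((pinnedChain ω₂ lam β γ).bathVecL N T) ((pinnedChain ω₂ lam β γ).bathVecR N T) (u r) (u r) x) :=
    ⟨_, rfl⟩
  obtain ⟨b, hb⟩ : ∃ b : ℝ → ℝ, b = fun r => ∫ x, π x * χ x ^ 2 * (2 * u r x * g r x) := ⟨_, rfl⟩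
  obtain ⟨c, hc⟩ : ∃ c : ℝ → ℝ, c = fun r => ∫ x, π x * (u r x ^ 2 * (8 * Γχ x - Lχ2 x)) := ⟨_, rfl⟩
  obtain ⟨E, hE⟩ : ∃ E : ℝ → ℝ, E = fun r => ∫ x, (π x * χ x ^ 2) * u r x ^ 2 := ⟨_, rfl⟩
  have hgoal : ∫ s in s₀..s₁, a s ≤ 2 * (CF ^ 2 * (∫ x, π x * χ x ^ 2) + (s₁ - s₀) * (CF ^ 2 * ∫ x, π x * |8 * Γχ x - Lχ2 x|)) := by
    -- basic regularity
    have hπc : Continuous π := by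
      rw [hπ]; exact Real.continuous_exp.comp (((pinnedChain_contDiff_hamiltonian ω₂ lam β γ N (n := 0)).continuous).neg.div_const T)
    have hπ0 : ∀ x, 0 < π x := fun x => (pinnedChain ω₂ lam β γ).gibbsDensity_pos N T x
    have hΓχc : Continuous Γχ := by
      have hD : Continuous (fderiv ℝ χ) := hχ.continuous_fderiv (by simp)
      rw [hΓχ, show carreDuChamp ((pinnedChain ω₂ lam β γ).bathVecL N T) ((pinnedChain ω₂ lam β γ).bathVecR N T) χ χ =
        fun x => _ from funext fun x => carreDuChamp_def _ _ χ χ x]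
      fun_prop
    have hLχ2c : Continuous Lχ2 :=
      (pinnedChain ω₂ lam β γ).continuous_generator (pinnedChain_contDiff_U ω₂ lam β γ)
        (pinnedChain_contDiff_V ω₂ lam β γ) N T T (hχ2.pow 2)
    have hχ2s : HasCompactSupport fun y => χ y ^ 2 := by
      have e : (fun y => χ y ^ 2) = fun y => χ y * χ y := funext fun y => sq _
      rw [e]; exact hχc.mul_right
    have hΓχs : HasCompactSupport Γχ := by
      rw [hΓχ, show carreDuChamp ((pinnedChain ω₂ lam β γ).bathVecL N T) ((pinnedChain ω₂ lam β γ).bathVecR N T) χ χ =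
        fun x => _ from funext fun x => carreDuChamp_def _ _ χ χ x]
      exact ((hχc.fderiv_apply (𝕜 := ℝ) _).mul_right).add ((hχc.fderiv_apply (𝕜 := ℝ) _).mul_right)
    have hLχ2s : HasCompactSupport Lχ2 := (pinnedChain ω₂ lam β γ).hasCompactSupport_generator N T T (hχ2.pow 2) hχ2s
    have hWs : HasCompactSupport fun x => 8 * Γχ x - Lχ2 x := (hΓχs.mul_left (f := fun _ => (8 : ℝ))).sub hLχ2s
    have hub : ∀ r z, |u r z| ≤ CF := fun r z => by rw [hux]; exact pinnedChain_abs_forecast_le hω hl hβ hγ.le N T T hCF _ z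
    -- joint continuity of `u` and `g`
    have hUc : ContinuousOn (fun w : ℝ × PhaseSpace N => u w.1 w.2) (Set.Ioi 0 ×ˢ Set.univ) := by
      have h := (pinnedChain_contDiffOn_forecast hω hl hβ hγ hN hT hT.le hF.continuous hFc).continuousOn
      rw [hu]; exact h
    have hGc : ContinuousOn (fun w : ℝ × PhaseSpace N => g w.1 w.2) (Set.Ioi 0 ×ˢ Set.univ) := by
      have h := (pinnedChain_contDiffOn_forecast hω hl hβ hγ hN hT hT.le hLc hLs).continuousOn
      rw [hg]; exact h
    have hΓUc := pinnedChain_continuousOn_carreDuChamp_forecast hω hl hβ hγ hN hT hT.le hF hFc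
      ((pinnedChain ω₂ lam β γ).bathVecL N T) ((pinnedChain ω₂ lam β γ).bathVecR N T)
    have hπ2 : ContinuousOn (fun w : ℝ × PhaseSpace N => π w.2) (Set.Ioi 0 ×ˢ Set.univ) := (hπc.comp continuous_snd).continuousOn
    have hχ2' : ContinuousOn (fun w : ℝ × PhaseSpace N => χ w.2 ^ 2) (Set.Ioi 0 ×ˢ Set.univ) :=
      ((hχ.continuous.comp continuous_snd).pow 2).continuousOn
    -- continuity in time of `a`, `b`, `c`
    have hac : ContinuousOn a (Set.Ioi 0) := by
      rw [ha]
      refine continuousOn_integral_of_continuousOn_prod (Φ := fun w => π w.2 * (χ w.2 ^ 2 *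
        carreDuChamp ((pinnedChain ω₂ lam β γ).bathVecL N T) ((pinnedChain ω₂ lam β γ).bathVecR N T) (u w.1) (u w.1) w.2))
        (hπ2.mul (hχ2'.mul ?_)) hχ2s.isCompact fun s x hx => ?_
      · rw [hu]; exact hΓUc
      · simp [image_eq_zero_of_notMem_tsupport hx]
    have hbc : ContinuousOn b (Set.Ioi 0) := by
      rw [hb]
      refine continuousOn_integral_of_continuousOn_prod (Φ := fun w => π w.2 * χ w.2 ^ 2 * (2 * u w.1 w.2 * g w.1 w.2))
        ((hπ2.mul hχ2').mul ((continuousOn_const.mul hUc).mul hGc)) hχ2s.isCompact fun s x hx => ?_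
      simp [image_eq_zero_of_notMem_tsupport hx]
    have hcc : ContinuousOn c (Set.Ioi 0) := by
      rw [hc]
      refine continuousOn_integral_of_continuousOn_prod (Φ := fun w => π w.2 * (u w.1 w.2 ^ 2 * (8 * Γχ w.2 - Lχ2 w.2)))
        (hπ2.mul ((hUc.pow 2).mul ?_)) hWs.isCompact fun s x hx => ?_
      · exact (((continuous_const.mul hΓχc).sub hLχ2c).comp continuous_snd).continuousOn
      · simp [image_eq_zero_of_notMem_tsupport hx]
    have hIcc : Set.Icc s₀ s₁ ⊆ Set.Ioi 0 := fun s hs => lt_of_lt_of_le hs₀ hs.1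
    have hai : IntervalIntegrable a volume s₀ s₁ := (hac.mono hIcc).intervalIntegrable_of_Icc hs₀₁
    have hbi : IntervalIntegrable b volume s₀ s₁ := (hbc.mono hIcc).intervalIntegrable_of_Icc hs₀₁
    have hci : IntervalIntegrable c volume s₀ s₁ := (hcc.mono hIcc).intervalIntegrable_of_Icc hs₀₁
    -- the differential inequality on `[s₀, s₁]`
    have hineq : ∀ s ∈ Set.Icc s₀ s₁, (1 / 2) * a s ≤ -b s + c s := by
      intro s hs
      have h := pinnedChain_energy_ineq hω hl hβ hγ hN hT hF hFc hχ hχc (lt_of_lt_of_le hs₀ hs.1)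
      rw [ha, hb, hc, hu, hg]
      exact h
    -- the fundamental theorem of calculus for `E`
    have hEd : ∀ s ∈ Set.uIcc s₀ s₁, HasDerivAt E (b s) s := by
      intro s hs
      rw [Set.uIcc_of_le hs₀₁] at hs
      have h := pinnedChain_hasDerivAt_integral_weight_forecast_sq hω hl hβ hγ hN hT hT.le hF hFc
        (hπc.mul (hχ.continuous.pow 2)) hχ2s.mul_left (lt_of_lt_of_le hs₀ hs.1)
      rw [hE, hb, hu, hg]
      exact h
    have hFTC : ∫ s in s₀..s₁, b s = E s₁ - E s₀ := intervalIntegral.integral_eq_sub_of_hasDerivAt hEd hbi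
    -- integrate the inequality
    have hbn : IntervalIntegrable (fun s => -b s) volume s₀ s₁ := hbi.neg
    have hbc : IntervalIntegrable (fun s => -b s + c s) volume s₀ s₁ := hbi.neg.add hci
    have hmono := intervalIntegral.integral_mono_on hs₀₁ (hai.const_mul (1 / 2)) hbc hineq
    rw [intervalIntegral.integral_const_mul, intervalIntegral.integral_add hbn hci,
      intervalIntegral.integral_neg, hFTC] at hmono
    -- bounds on `E` and `c`
    have hE0 : 0 ≤ E s₁ := by
      rw [hE]
      exact integral_nonneg fun x => mul_nonneg (mul_nonneg (hπ0 x).le (sq_nonneg _)) (sq_nonneg _)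
    have hEs₀ : E s₀ ≤ CF ^ 2 * ∫ x, π x * χ x ^ 2 := by
      rw [hE, ← integral_const_mul]
      refine integral_mono_of_nonneg (Eventually.of_forall fun x =>
        mul_nonneg (mul_nonneg (hπ0 x).le (sq_nonneg _)) (sq_nonneg _)) ?_ (Eventually.of_forall fun x => ?_)
      · exact ((hπc.mul (hχ.continuous.pow 2)).integrable_of_hasCompactSupport hχ2s.mul_left).const_mul _
      · have h1 : u s₀ x ^ 2 ≤ CF ^ 2 := by
          have := hub s₀ x
          rw [← sq_abs]
          exact pow_le_pow_left₀ (abs_nonneg _) this 2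
        have h2 : 0 ≤ π x * χ x ^ 2 := mul_nonneg (hπ0 x).le (sq_nonneg _)
        simp only
        nlinarith
    have hcs : ∀ s ∈ Set.Icc s₀ s₁, c s ≤ CF ^ 2 * ∫ x, π x * |8 * Γχ x - Lχ2 x| := by
      intro s _
      rw [hc, ← integral_const_mul]
      have hus : Continuous (u s) := by
        rw [hu]
        exact pinnedChain_continuous_integral_transitionKernel hω hl hβ hγ.le N T T _ hF.continuous
          (fun y => by rw [Real.norm_eq_abs]; exact hCF y)
      refine integral_mono ?_ ?_ (fun x => ?_)
      · exact (hπc.mul ((hus.pow 2).mul ((continuous_const.mul hΓχc).sub hLχ2c))).integrable_of_hasCompactSupport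
          (hWs.mul_left.mul_left)
      · exact ((hπc.mul ((continuous_const.mul hΓχc).sub hLχ2c).abs).integrable_of_hasCompactSupport
          (hWs.norm.mul_left)).const_mul _
      · have h1 : u s x ^ 2 ≤ CF ^ 2 := by
          have := hub s x
          rw [← sq_abs]
          exact pow_le_pow_left₀ (abs_nonneg _) this 2
        have h3 : u s x ^ 2 * (8 * Γχ x - Lχ2 x) ≤ CF ^ 2 * |8 * Γχ x - Lχ2 x| := by
          calc _ ≤ u s x ^ 2 * |8 * Γχ x - Lχ2 x| := mul_le_mul_of_nonneg_left (le_abs_self _) (sq_nonneg _)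
            _ ≤ _ := mul_le_mul_of_nonneg_right h1 (abs_nonneg _)
        simp only
        nlinarith [(hπ0 x).le, h3]
    have hcint : ∫ s in s₀..s₁, c s ≤ (s₁ - s₀) * (CF ^ 2 * ∫ x, π x * |8 * Γχ x - Lχ2 x|) := by
      have h := intervalIntegral.integral_mono_on hs₀₁ hci intervalIntegrable_const hcs
      rwa [intervalIntegral.integral_const, smul_eq_mul] at h
    linarith
  rw [ha] at hgoal
  rw [hu] at hgoal
  exact hgoal

end Energy

end Summit.AtomisticToContinuum.FouriersLaw.Theorems

end
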